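import Mathlib.Analysis.Calculus.Deriv.Inv
import Mathlib.Analysis.Calculus.Deriv.Pow
import Mathlib.Analysis.Calculus.Deriv.Mul
import Literature.Geometry.Lorentzian.Sweep2
import Literature.Geometry.Lorentzian.KerrTimelikeSpan
import HarnessLib

/-!
# The potential `V = V₀ + V₁` of Carter's radial ODE on subextremal Kerr: admissible
# frequencies, `V₁ ≥ 0`, and the horizon values (DRSR §6.1–6.2, Lemmas 6.3.2 and 6.4.1)

(family `gr`, infrastructure for statement **gr.S24**; namespace `Literature.Geometry.Lorentzian.Kerr`)

Carter's separation of `□_g ψ = 0` on Kerr (Dafermos–Rodnianski–Shlapentokh-Rothman, *Decay for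
solutions of the wave equation on Kerr exterior spacetimes III*, arXiv:1402.7034 = Ann. of Math.
183 (2016), Prop. 5.2.1) leads to the radial ODE `u'' + (ω² − V) u = H` in `r*`, with the
potential (loc. cit. §5.2.3, display after Prop. 5.2.1)
`V = (4Mramω − a²m² + Δ(λ_{mℓ} + a²ω²))/(r² + a²)² + Δ(3r² − 4Mr + a²)/(r² + a²)³ − 3Δ²r²/(r² + a²)⁴`,
`Δ = r² − 2Mr + a²`. Its §6 ("Properties of the potential `V`") is, with §§7–8, "an independent
logical unit of this paper which culminates in Theorem 8.1" (loc. cit. Remark 6.1): pure real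
analysis of `V` as a function of `r > r₊` and of the frequency parameters, which enter only
through `ω`, `m` and `Λ = λ_{mℓ}(aω) + a²ω²`, constrained by `Λ ≥ |m|(|m| + 1)`, `Λ ≥ 2|amω|`
(Def. 6.1.1, "admissible frequency triples"). This file transcribes these objects and **proves**
the first results of that unit:

* `Kerr.IsAdmissibleTriple a ω m Λ` (Def. 6.1.1) and elementary facts on `Δ = Kerr.delta M a r`
  (the definition of `Sweep2.lean`: `Δ = (r − r₊)(r − r₋)`, `Δ(r₊) = 0`, `Δ > 0` on `r > r₊`;
  `r₊² + a² = 2Mr₊` and `ω₊` are `Kerr.rPlus_sq_add_sq`, `Kerr.horizonAngularVelocity` of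
  `KerrTimelikeSpan.lean`),
  `Kerr.sepPotential₀` / `Kerr.sepPotential₁` / `Kerr.sepPotential` (`V₀`, `V₁`, `V = V₀ + V₁`,
  §6.2), with the printed closed form (`sepPotential_eq`) and the Schwarzschild case
  `V = (r − 2M)(ℓ(ℓ+1)/r³ + 2M/r⁴)` (`sepPotential_schwarzschild`, §5.2.3);
* §6.2: `V₁ = Δ (a²Δ + 2Mr(r² − a²))/(r² + a²)⁴` and hence `V₁ ≥ 0` on `r ≥ r₊`
  (`sepPotential₁_eq`, `sepPotential₁_nonneg`), `V₁(r₊) = 0`;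
* **Lemma 6.3.2**: `ω² − V(r₊) = (2Mr₊ω − am)²/(4M²r₊²)`, so `ω² ≥ V(r₊)` with equality iff
  `ω = ω₊ m`, `ω₊ = a/(2Mr₊)` (`omega_sq_sub_sepPotential_rPlus`, `sepPotential_rPlus_le`,
  `sepPotential_rPlus_eq_iff`);
* the derivative `dV₀/dr = (4maMω(−3r² + a²) + 4ra²m² − 2Λ(r³ + a²r − 3Mr² + Ma²))/(r² + a²)³`
  (proof of Lemma 6.3.1, first display; `hasDerivAt_sepPotential₀`) and **Lemma 6.4.1** (first
  assertion) with an explicit constant: for `0 ≤ a < M` and admissible triples with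
  `mω ≤ am²/(2Mr₊)` (a range containing the superradiant frequencies),
  `dV/dr(r₊) ≥ dV₀/dr(r₊) ≥ 4(r₊ − M)(Mr₊ − a²) Λ/(r₊² + a²)³ ≥ 0`
  (`le_deriv_sepPotential₀_rPlus`, `deriv_sepPotential₀_rPlus_le_deriv_sepPotential_rPlus`,
  `hasDerivAt_sepPotential₁_rPlus`: `dV₁/dr(r₊) = 4Mr₊(r₊ − M)(r₊² − a²)/(r₊² + a²)⁴ ≥ 0`).

Not formalised here: the critical-point structure of `V₀` (Lemma 6.3.1) and with it the clause
"in particular `ω² > V₀(r⁰_min)`" of Lemma 6.3.2, "superradiant frequencies are not trapped"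
(Lemma 6.4.2, which needs the uniform constants of Lemma 6.3.1), and Lemma 6.5.1; nor anything about the separation itself (oblate spheroidal harmonics, §5), which the
prelude cannot yet express. As in loc. cit. §4.2 and Remark 6.1, the frequency-dependent
statements of §6.4 use the reduction to `a ≥ 0`.

## References

* M. Dafermos, I. Rodnianski, Y. Shlapentokh-Rothman, arXiv:1402.7034 = Ann. of Math. 183 (2016):
  §2.1.2 (`r±`, `Δ`), §2.2.2 (`ω₊ = a/(2Mr₊)`), §4.2 (the sign of `a`), Prop. 5.2.1 and the
  display following it (`V`), Def. 6.1.1, §6.2 (`V₀`, `V₁`, `V₁ ≥ 0`), Lemma 6.3.1 (proof, first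
  display), Lemma 6.3.2, Lemma 6.4.1 (key `DafermosRodnianskiShlapentokhrothman2014`).
-/

noncomputable section

namespace Literature.Geometry.Lorentzian

namespace Kerr

/-! ### `Δ = r² − 2Mr + a²` (`Kerr.delta` of `Sweep2.lean`) on and outside the horizon -/

/-- `Δ = (r − r₊)(r − r₋)` for `|a| ≤ M` (`r± = M ± √(M² − a²)`). DRSR arXiv:1402.7034, §2.1.2.
[cite: DafermosRodnianskiShlapentokhrothman2014, §2.1.2] -/
theorem delta_eq_mul {M a : ℝ} (h : |a| ≤ M) (r : ℝ) :
    delta M a r = (r - rPlus M a) * (r - rMinus M a) := by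
  have ha : a ^ 2 ≤ M ^ 2 := by nlinarith [sq_abs a, abs_nonneg a]
  have hs : √(M ^ 2 - a ^ 2) ^ 2 = M ^ 2 - a ^ 2 := Real.sq_sqrt (sub_nonneg.2 ha)
  unfold delta rPlus rMinus
  nlinarith [hs]

/-- `Δ(r₊) = 0` for `|a| ≤ M`. DRSR arXiv:1402.7034, §2.1.2 ("`Δ` vanishes to first order on
`𝓗⁺`"). [cite: DafermosRodnianskiShlapentokhrothman2014, §2.1.2] -/
theorem delta_rPlus {M a : ℝ} (h : |a| ≤ M) : delta M a (rPlus M a) = 0 := by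
  rw [delta_eq_mul h, sub_self, zero_mul]

/-- `Δ > 0` for `r > r₊` and `|a| ≤ M` (both factors of `(r − r₊)(r − r₋)` are positive, `r₋ ≤ r₊`).
DRSR arXiv:1402.7034, §2.1.2. [cite: DafermosRodnianskiShlapentokhrothman2014, §2.1.2] -/
theorem delta_pos {M a r : ℝ} (h : |a| ≤ M) (hr : rPlus M a < r) : 0 < delta M a r := by
  rw [delta_eq_mul h]
  exact mul_pos (sub_pos.2 hr) (sub_pos.2 ((rMinus_le_rPlus M a).trans_lt hr))

/-- `Δ ≥ 0` for `r ≥ r₊` and `|a| ≤ M`. DRSR arXiv:1402.7034, §2.1.2. [cite: DafermosRodnianskiShlapentokhrothman2014, §2.1.2] -/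
theorem delta_nonneg {M a r : ℝ} (h : |a| ≤ M) (hr : rPlus M a ≤ r) : 0 ≤ delta M a r := by
  rw [delta_eq_mul h]
  exact mul_nonneg (sub_nonneg.2 hr) (sub_nonneg.2 ((rMinus_le_rPlus M a).trans hr))

/-! ### Derivatives of `Δ` and of the denominators `(r² + a²)ⁿ` -/

/-- `dΔ/dr = 2(r − M)`. DRSR arXiv:1402.7034, §2.1.2. [folklore] -/
theorem hasDerivAt_delta (M a r : ℝ) : HasDerivAt (delta M a) (2 * (r - M)) r := by
  have h := (((hasDerivAt_id r).pow 2).sub ((hasDerivAt_id r).const_mul (2 * M))).add_const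
    (a ^ 2)
  have h' : HasDerivAt (fun s : ℝ ↦ s ^ 2 - 2 * M * s + a ^ 2) (2 * (r - M)) r :=
    h.congr_deriv (by simp; ring)
  exact h'

/-- `d/dr (r² + a²)ⁿ = n (r² + a²)ⁿ⁻¹ · 2r` (chain rule; the denominators of `V`). [folklore] -/
theorem hasDerivAt_sq_add_sq_pow (a : ℝ) (n : ℕ) (r : ℝ) :
    HasDerivAt (fun s : ℝ ↦ (s ^ 2 + a ^ 2) ^ n) (n * (r ^ 2 + a ^ 2) ^ (n - 1) * (2 * r)) r := by
  have h := (((hasDerivAt_id r).pow 2).add_const (a ^ 2)).pow n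
  have h' : HasDerivAt (fun s : ℝ ↦ (s ^ 2 + a ^ 2) ^ n)
      (n * (r ^ 2 + a ^ 2) ^ (n - 1) * (2 * r)) r :=
    h.congr_deriv (by simp)
  exact h'

/-! ### Admissible frequency triples and the potential `V = V₀ + V₁` -/

/-- **Admissible frequency triples** (DRSR arXiv:1402.7034, Def. 6.1.1): `ω ∈ ℝ`, `m ∈ ℤ`,
`Λ ∈ ℝ` with `Λ ≥ |m|(|m| + 1)` and `Λ ≥ 2|amω|` — the only constraints on
`Λ = λ_{mℓ}(aω) + a²ω²` that the analysis of the potential uses (loc. cit. §6.1).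
[cite: DafermosRodnianskiShlapentokhrothman2014, Def. 6.1.1] -/
def IsAdmissibleTriple (a ω : ℝ) (m : ℤ) (Λ : ℝ) : Prop :=
  |(m : ℝ)| * (|(m : ℝ)| + 1) ≤ Λ ∧ 2 * |a * m * ω| ≤ Λ

/-- For an admissible triple, `Λ ≥ m²` (from `Λ ≥ |m|(|m| + 1)`). DRSR arXiv:1402.7034, proof of
Lemma 6.4.1 ("the inequalities `Λ ≥ m²` …"). [cite: DafermosRodnianskiShlapentokhrothman2014, Lemma 6.4.1 (proof)] -/
theorem IsAdmissibleTriple.sq_le {a ω : ℝ} {m : ℤ} {Λ : ℝ} (h : IsAdmissibleTriple a ω m Λ) :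
    (m : ℝ) ^ 2 ≤ Λ := by
  have h1 := h.1
  have h0 : 0 ≤ |(m : ℝ)| := abs_nonneg _
  nlinarith [sq_abs (m : ℝ)]

/-- For an admissible triple, `Λ ≥ 0`. DRSR arXiv:1402.7034, Def. 6.1.1. [cite: DafermosRodnianskiShlapentokhrothman2014, Def. 6.1.1] -/
theorem IsAdmissibleTriple.nonneg {a ω : ℝ} {m : ℤ} {Λ : ℝ} (h : IsAdmissibleTriple a ω m Λ) :
    0 ≤ Λ :=
  (sq_nonneg (m : ℝ)).trans h.sq_le

/-- The **frequency-dependent part** `V₀ = (4Mramω − a²m² + ΔΛ)/(r² + a²)²` of the potential.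
Junk value `0` where `r² + a² = 0`, i.e. only at `r = a = 0` (Mathlib's `x / 0 = 0`; never used:
the potential matters on `r > r₊ > 0`). DRSR arXiv:1402.7034, §6.2. [cite: DafermosRodnianskiShlapentokhrothman2014, §6.2] -/
def sepPotential₀ (M a ω : ℝ) (m : ℤ) (Λ r : ℝ) : ℝ :=
  (4 * M * r * a * m * ω - a ^ 2 * (m : ℝ) ^ 2 + delta M a r * Λ) / (r ^ 2 + a ^ 2) ^ 2

/-- The **frequency-independent part** `V₁ = Δ(3r² − 4Mr + a²)/(r² + a²)³ − 3Δ²r²/(r² + a²)⁴` of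
the potential (junk value `0` at `r = a = 0`, as for `V₀`). DRSR arXiv:1402.7034, §6.2. [cite: DafermosRodnianskiShlapentokhrothman2014, §6.2] -/
def sepPotential₁ (M a r : ℝ) : ℝ :=
  delta M a r * (3 * r ^ 2 - 4 * M * r + a ^ 2) / (r ^ 2 + a ^ 2) ^ 3 -
    3 * delta M a r ^ 2 * r ^ 2 / (r ^ 2 + a ^ 2) ^ 4

/-- The **potential** `V(ω, m, Λ)(r) = V₀ + V₁` of Carter's radial ODE
`u'' + (ω² − V) u = H` (in `r*`), with the eigenvalue combination `λ_{mℓ}(aω) + a²ω²` replaced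
by the free parameter `Λ`. DRSR arXiv:1402.7034, §5.2.3 (display after Prop. 5.2.1) and §6.2
("Decomposition of the potential"). [cite: DafermosRodnianskiShlapentokhrothman2014, §6.2] -/
def sepPotential (M a ω : ℝ) (m : ℤ) (Λ r : ℝ) : ℝ :=
  sepPotential₀ M a ω m Λ r + sepPotential₁ M a r

/-- `V` is the printed expression
`(4Mramω − a²m² + ΔΛ)/(r² + a²)² + Δ(3r² − 4Mr + a²)/(r² + a²)³ − 3Δ²r²/(r² + a²)⁴`
(DRSR arXiv:1402.7034, §5.2.3, display after Prop. 5.2.1, with `λ_{mℓ} + ω²a² = Λ`).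
[cite: DafermosRodnianskiShlapentokhrothman2014, Prop. 5.2.1 (display following)] -/
theorem sepPotential_eq (M a ω : ℝ) (m : ℤ) (Λ r : ℝ) :
    sepPotential M a ω m Λ r =
      (4 * M * r * a * m * ω - a ^ 2 * (m : ℝ) ^ 2 + (r ^ 2 - 2 * M * r + a ^ 2) * Λ) /
          (r ^ 2 + a ^ 2) ^ 2 +
        (r ^ 2 - 2 * M * r + a ^ 2) * (3 * r ^ 2 - 4 * M * r + a ^ 2) / (r ^ 2 + a ^ 2) ^ 3 -
        3 * (r ^ 2 - 2 * M * r + a ^ 2) ^ 2 * r ^ 2 / (r ^ 2 + a ^ 2) ^ 4 := by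
  simp only [sepPotential, sepPotential₀, sepPotential₁, delta]
  ring

/-- **The Schwarzschild case**: for `a = 0` and `Λ = ℓ(ℓ + 1)`,
`V = (r − 2M)(ℓ(ℓ+1)/r³ + 2M/r⁴)` for `r ≠ 0` (the Regge–Wheeler-type potential).
DRSR arXiv:1402.7034, §5.2.3 (last display). [cite: DafermosRodnianskiShlapentokhrothman2014, §5.2.3] -/
theorem sepPotential_schwarzschild (M ω : ℝ) (m : ℤ) (ℓ : ℕ) {r : ℝ} (hr : r ≠ 0) :
    sepPotential M 0 ω m (ℓ * (ℓ + 1)) r = (r - 2 * M) * (ℓ * (ℓ + 1) / r ^ 3 + 2 * M / r ^ 4) := by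
  simp only [sepPotential, sepPotential₀, sepPotential₁, delta]
  field_simp
  ring

/-! ### §6.2: `V₁ ≥ 0` -/

/-- `V₁ = Δ (a²Δ + 2Mr(r² − a²))/(r² + a²)⁴` (DRSR arXiv:1402.7034, §6.2, the display
"Note also the nonnegativity property"), wherever `r² + a² ≠ 0`. [cite: DafermosRodnianskiShlapentokhrothman2014, §6.2] -/
theorem sepPotential₁_eq (M a : ℝ) {r : ℝ} (hr : r ^ 2 + a ^ 2 ≠ 0) :
    sepPotential₁ M a r =
      delta M a r / (r ^ 2 + a ^ 2) ^ 4 * (a ^ 2 * delta M a r + 2 * M * r * (r ^ 2 - a ^ 2)) := by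
  unfold sepPotential₁ delta
  field_simp
  ring

/-- **`V₁ ≥ 0` on the exterior**: for `|a| ≤ M` and `r ≥ r₊` (there `Δ ≥ 0` and
`r ≥ r₊ ≥ M ≥ |a|`, so `r² ≥ a²`). DRSR arXiv:1402.7034, §6.2. [cite: DafermosRodnianskiShlapentokhrothman2014, §6.2] -/
theorem sepPotential₁_nonneg {M a r : ℝ} (h : |a| ≤ M) (hr : rPlus M a ≤ r) :
    0 ≤ sepPotential₁ M a r := by
  have hM : 0 ≤ M := (abs_nonneg a).trans h
  have hMr : M ≤ rPlus M a := by
    unfold rPlus; linarith [Real.sqrt_nonneg (M ^ 2 - a ^ 2)]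
  have har : a ^ 2 ≤ r ^ 2 := by
    have h1 : |a| ≤ r := h.trans (hMr.trans hr)
    nlinarith [abs_nonneg a, sq_abs a]
  have hr0 : 0 ≤ r := (abs_nonneg a).trans (h.trans (hMr.trans hr))
  have hΔ := delta_nonneg h hr
  rcases eq_or_lt_of_le (show (0 : ℝ) ≤ r ^ 2 + a ^ 2 by positivity) with hA | hA
  · -- degenerate case `r = a = 0`: everything is the junk value `0`
    simp [sepPotential₁, ← hA]
  rw [sepPotential₁_eq M a hA.ne']
  apply mul_nonneg (div_nonneg hΔ (by positivity))
  nlinarith [mul_nonneg (mul_nonneg hM hr0) (sub_nonneg.2 har), mul_nonneg (sq_nonneg a) hΔ]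

/-- `V₁(r₊) = 0` (`Δ(r₊) = 0`), for `|a| ≤ M`. DRSR arXiv:1402.7034, §6.2 with §2.1.2. [cite: DafermosRodnianskiShlapentokhrothman2014, §6.2] -/
theorem sepPotential₁_rPlus {M a : ℝ} (h : |a| ≤ M) : sepPotential₁ M a (rPlus M a) = 0 := by
  simp [sepPotential₁, delta_rPlus h]

/-- `V(r₊) = V₀(r₊) = (4Mr₊amω − a²m²)/(r₊² + a²)²`, for `|a| ≤ M`. DRSR arXiv:1402.7034, proof of
Lemma 6.3.2. [cite: DafermosRodnianskiShlapentokhrothman2014, Lemma 6.3.2 (proof)] -/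
theorem sepPotential_rPlus {M a : ℝ} (h : |a| ≤ M) (ω : ℝ) (m : ℤ) (Λ : ℝ) :
    sepPotential M a ω m Λ (rPlus M a) =
      (4 * M * rPlus M a * a * m * ω - a ^ 2 * (m : ℝ) ^ 2) / (rPlus M a ^ 2 + a ^ 2) ^ 2 := by
  simp [sepPotential, sepPotential₀, sepPotential₁_rPlus h, delta_rPlus h]

/-! ### Lemma 6.3.2: `ω² ≥ V(r₊)`, with equality exactly at the superradiant threshold -/

/-- **DRSR Lemma 6.3.2, the identity**: `ω² − V(r₊) = (2Mr₊ω − am)²/(4M²r₊²)` for `|a| ≤ M`,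
`0 < M` (using `r₊² + a² = 2Mr₊`). DRSR arXiv:1402.7034, Lemma 6.3.2 (proof). [cite: DafermosRodnianskiShlapentokhrothman2014, Lemma 6.3.2] -/
theorem omega_sq_sub_sepPotential_rPlus {M a : ℝ} (h : |a| ≤ M) (hM : 0 < M) (ω : ℝ) (m : ℤ)
    (Λ : ℝ) :
    ω ^ 2 - sepPotential M a ω m Λ (rPlus M a) =
      (2 * M * rPlus M a * ω - a * m) ^ 2 / (4 * M ^ 2 * rPlus M a ^ 2) := by
  have hr : 0 < rPlus M a := by
    unfold rPlus; linarith [Real.sqrt_nonneg (M ^ 2 - a ^ 2)]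
  rw [sepPotential_rPlus h, rPlus_sq_add_sq h]
  have h2 : 2 * M * rPlus M a ≠ 0 := by positivity
  field_simp
  ring

/-- **DRSR Lemma 6.3.2**: `V(r₊) ≤ ω²` for every frequency triple (`|a| ≤ M`, `0 < M`).
[cite: DafermosRodnianskiShlapentokhrothman2014, Lemma 6.3.2] -/
theorem sepPotential_rPlus_le {M a : ℝ} (h : |a| ≤ M) (hM : 0 < M) (ω : ℝ) (m : ℤ) (Λ : ℝ) :
    sepPotential M a ω m Λ (rPlus M a) ≤ ω ^ 2 := by
  have := omega_sq_sub_sepPotential_rPlus h hM ω m Λ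
  have h0 : 0 ≤ (2 * M * rPlus M a * ω - a * m) ^ 2 / (4 * M ^ 2 * rPlus M a ^ 2) := by
    positivity
  linarith

/-- **DRSR Lemma 6.3.2, the equality case**: `V(r₊) = ω²` iff `ω = ω₊ m`, `ω₊ = a/(2Mr₊)` the
angular velocity of the horizon (`Kerr.horizonAngularVelocity` of `KerrTimelikeSpan.lean`) —
precisely the threshold `ω(ω − ω₊m) = 0` of the superradiant condition (loc. cit. §2.3.3).
[cite: DafermosRodnianskiShlapentokhrothman2014, Lemma 6.3.2] -/
theorem sepPotential_rPlus_eq_iff {M a : ℝ} (h : |a| ≤ M) (hM : 0 < M) (ω : ℝ) (m : ℤ) (Λ : ℝ) :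
    sepPotential M a ω m Λ (rPlus M a) = ω ^ 2 ↔ ω = horizonAngularVelocity M a * m := by
  unfold horizonAngularVelocity
  have hr : 0 < rPlus M a := by
    unfold rPlus; linarith [Real.sqrt_nonneg (M ^ 2 - a ^ 2)]
  have hid := omega_sq_sub_sepPotential_rPlus h hM ω m Λ
  have h4 : 0 < 4 * M ^ 2 * rPlus M a ^ 2 := by positivity
  have h2 : 0 < 2 * M * rPlus M a := by positivity
  constructor
  · intro heq
    have h0 : (2 * M * rPlus M a * ω - a * m) ^ 2 / (4 * M ^ 2 * rPlus M a ^ 2) = 0 := by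
      rw [← hid, heq, sub_self]
    have h1 : 2 * M * rPlus M a * ω - a * m = 0 := by
      rcases (div_eq_zero_iff.1 h0) with h' | h'
      · exact pow_eq_zero_iff (n := 2) (by norm_num) |>.1 h'
      · exact absurd h' h4.ne'
    rw [div_mul_eq_mul_div, eq_div_iff h2.ne']
    linarith
  · intro hω
    have h1 : 2 * M * rPlus M a * ω - a * m = 0 := by
      rw [hω]; field_simp; ring
    have : ω ^ 2 - sepPotential M a ω m Λ (rPlus M a) = 0 := by
      rw [hid, h1]; simp
    linarith

/-! ### The derivative of `V₀` and Lemma 6.4.1 -/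

/-- **The derivative of `V₀`**:
`dV₀/dr = (4maMω(−3r² + a²) + 4ra²m² − 2Λ(r³ + a²r − 3Mr² + Ma²))/(r² + a²)³` wherever
`r² + a² ≠ 0`. DRSR arXiv:1402.7034, proof of Lemma 6.3.1 (first display). [cite: DafermosRodnianskiShlapentokhrothman2014, Lemma 6.3.1 (proof)] -/
theorem hasDerivAt_sepPotential₀ (M a ω : ℝ) (m : ℤ) (Λ : ℝ) {r : ℝ} (hr : r ^ 2 + a ^ 2 ≠ 0) :
    HasDerivAt (sepPotential₀ M a ω m Λ)
      ((4 * m * a * M * ω * (-3 * r ^ 2 + a ^ 2) + 4 * r * a ^ 2 * (m : ℝ) ^ 2 -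
        2 * Λ * (r ^ 3 + a ^ 2 * r - 3 * M * r ^ 2 + M * a ^ 2)) / (r ^ 2 + a ^ 2) ^ 3) r := by
  have h1 : HasDerivAt (fun s : ℝ ↦ 4 * M * s * a * m * ω) (4 * M * a * m * ω) r := by
    have h := (hasDerivAt_id r).const_mul (4 * M * a * m * ω)
    have h' : HasDerivAt (fun s : ℝ ↦ 4 * M * a * m * ω * s) (4 * M * a * m * ω) r :=
      h.congr_deriv (by simp)
    refine h'.congr_of_eventuallyEq (Filter.Eventually.of_forall fun s ↦ ?_)
    ring
  have hN : HasDerivAt (fun s ↦ 4 * M * s * a * m * ω - a ^ 2 * (m : ℝ) ^ 2 + delta M a s * Λ)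
      (4 * M * a * m * ω - 0 + 2 * (r - M) * Λ) r :=
    (h1.sub (hasDerivAt_const r (a ^ 2 * (m : ℝ) ^ 2))).add
      ((hasDerivAt_delta M a r).mul_const Λ)
  have h := hN.div (hasDerivAt_sq_add_sq_pow a 2 r) (by positivity)
  have h' : HasDerivAt (sepPotential₀ M a ω m Λ)
      (((4 * M * a * m * ω - 0 + 2 * (r - M) * Λ) * (r ^ 2 + a ^ 2) ^ 2 -
        (4 * M * r * a * m * ω - a ^ 2 * (m : ℝ) ^ 2 + delta M a r * Λ) *
          ((2 : ℕ) * (r ^ 2 + a ^ 2) ^ (2 - 1) * (2 * r))) / ((r ^ 2 + a ^ 2) ^ 2) ^ 2) r := h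
  refine h'.congr_deriv ?_
  field_simp
  unfold delta
  push_cast
  ring

/-- The value `dV₀/dr(r₊) = (4maMω(−3r₊² + a²) + 4r₊a²m² + 2(r₊² + a²)(r₊ − M)Λ)/(r₊² + a²)³`
(`|a| ≤ M`, `0 < M`; the general formula at `r₊`, simplified with `Δ(r₊) = 0`). DRSR
arXiv:1402.7034, proof of Lemma 6.4.1 (first display). [cite: DafermosRodnianskiShlapentokhrothman2014, Lemma 6.4.1 (proof)] -/
theorem hasDerivAt_sepPotential₀_rPlus {M a : ℝ} (h : |a| ≤ M) (hM : 0 < M) (ω : ℝ) (m : ℤ)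
    (Λ : ℝ) :
    HasDerivAt (sepPotential₀ M a ω m Λ)
      ((4 * m * a * M * ω * (-3 * rPlus M a ^ 2 + a ^ 2) + 4 * rPlus M a * a ^ 2 * (m : ℝ) ^ 2 +
        2 * (rPlus M a ^ 2 + a ^ 2) * (rPlus M a - M) * Λ) / (rPlus M a ^ 2 + a ^ 2) ^ 3)
      (rPlus M a) := by
  have hr : 0 < rPlus M a := by
    unfold rPlus; linarith [Real.sqrt_nonneg (M ^ 2 - a ^ 2)]
  have hA : rPlus M a ^ 2 + a ^ 2 ≠ 0 := by positivity
  refine (hasDerivAt_sepPotential₀ M a ω m Λ hA).congr_deriv ?_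
  have hΔ := delta_rPlus h
  unfold delta at hΔ
  congr 1
  linear_combination (-4 * Λ * rPlus M a) * hΔ

/-- **DRSR Lemma 6.4.1 (first assertion, for `V₀`), with an explicit constant.** Let
`0 < M`, `0 ≤ a < M`, and let `(ω, m, Λ)` be an admissible frequency triple with
`mω ≤ am²/(2Mr₊)` (this range contains the superradiant frequencies `0 < mω ≤ am²/(2Mr₊)` and all
`mω ≤ 0`). Then `dV₀/dr(r₊) ≥ b Λ ≥ 0` with `b = 4(r₊ − M)(Mr₊ − a²)/(r₊² + a²)³ > 0`
(`deriv_sepPotential₀_rPlus_const_pos`). Printed: "`dV/dr(r₊) ≥ dV₀/dr(r₊) ≥ bΛ ≥ 0`", with the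
proof's bound `(r₊² + a²)³ dV₀/dr(r₊) ≥ 4(r₊ − M)(ΛMr₊ − a²m²)` and `Λ ≥ m²`, `r₊ > M > a`. As in
loc. cit. the statement uses the reduction to `a ≥ 0` (§4.2). [cite: DafermosRodnianskiShlapentokhrothman2014, Lemma 6.4.1] -/
theorem le_deriv_sepPotential₀_rPlus {M a ω Λ : ℝ} {m : ℤ} (hM : 0 < M) (ha0 : 0 ≤ a)
    (haM : a < M) (hadm : IsAdmissibleTriple a ω m Λ)
    (hsr : m * ω ≤ a * (m : ℝ) ^ 2 / (2 * M * rPlus M a)) :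
    4 * (rPlus M a - M) * (M * rPlus M a - a ^ 2) * Λ / (rPlus M a ^ 2 + a ^ 2) ^ 3 ≤
      deriv (sepPotential₀ M a ω m Λ) (rPlus M a) := by
  have h : |a| ≤ M := by rw [abs_of_nonneg ha0]; exact haM.le
  have hr : 0 < rPlus M a := by
    unfold rPlus; linarith [Real.sqrt_nonneg (M ^ 2 - a ^ 2)]
  have hrM : M < rPlus M a := by
    have : 0 < √(M ^ 2 - a ^ 2) := Real.sqrt_pos.2 (by nlinarith)
    unfold rPlus; linarith
  set r := rPlus M a with hr_def
  have hA := rPlus_sq_add_sq h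
  rw [← hr_def] at hA
  rw [(hasDerivAt_sepPotential₀_rPlus h hM ω m Λ).deriv, ← hr_def]
  have hA3 : 0 < (r ^ 2 + a ^ 2) ^ 3 := by positivity
  rw [div_le_div_iff_of_pos_right hA3]
  have hΛ := hadm.nonneg
  have hm2 := hadm.sq_le
  -- the printed chain: numerator `≥ 4(r₊ − M)(ΛMr₊ − a²m²) ≥ 4(r₊ − M)(Mr₊ − a²)Λ`
  have hstep2 : 4 * (r - M) * (M * r - a ^ 2) * Λ ≤ 4 * (r - M) * (Λ * M * r - a ^ 2 * (m : ℝ) ^ 2) := by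
    have : 0 ≤ 4 * (r - M) := by linarith
    nlinarith [mul_le_mul_of_nonneg_left hm2 (sq_nonneg a)]
  have hstep1 : 4 * (r - M) * (Λ * M * r - a ^ 2 * (m : ℝ) ^ 2) ≤
      4 * m * a * M * ω * (-3 * r ^ 2 + a ^ 2) + 4 * r * a ^ 2 * (m : ℝ) ^ 2 +
        2 * (r ^ 2 + a ^ 2) * (r - M) * Λ := by
    have hneg : -3 * r ^ 2 + a ^ 2 < 0 := by nlinarith
    rcases le_or_gt ((m : ℝ) * ω) 0 with hmω | hmω
    · -- `mω ≤ 0`: the first term is nonnegative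
      have h1 : 0 ≤ 4 * m * a * M * ω * (-3 * r ^ 2 + a ^ 2) := by
        have : 4 * m * a * M * ω * (-3 * r ^ 2 + a ^ 2) =
            (4 * a * M) * ((m : ℝ) * ω) * (-3 * r ^ 2 + a ^ 2) := by ring
        rw [this]
        exact mul_nonneg_of_nonpos_of_nonpos
          (mul_nonpos_of_nonneg_of_nonpos (by positivity) hmω) hneg.le
      have e : 2 * (r ^ 2 + a ^ 2) * (r - M) * Λ = 4 * M * r * (r - M) * Λ := by rw [hA]; ring
      have p1 : 0 ≤ r * (a ^ 2 * (m : ℝ) ^ 2) := mul_nonneg hr.le (by positivity)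
      have p2 : 0 ≤ (r - M) * (a ^ 2 * (m : ℝ) ^ 2) := mul_nonneg (by linarith) (by positivity)
      nlinarith [e, h1, p1, p2]
    · -- `0 < mω ≤ am²/(2Mr₊)`: substitute the upper bound (the coefficient is nonpositive)
      have hcoef : 4 * a * M * (-3 * r ^ 2 + a ^ 2) ≤ 0 :=
        mul_nonpos_of_nonneg_of_nonpos (by positivity) hneg.le
      have h1 : 4 * a * M * (-3 * r ^ 2 + a ^ 2) * (a * (m : ℝ) ^ 2 / (2 * M * r)) ≤
          4 * a * M * (-3 * r ^ 2 + a ^ 2) * ((m : ℝ) * ω) :=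
        mul_le_mul_of_nonpos_left hsr hcoef
      have h2 : 4 * a * M * (-3 * r ^ 2 + a ^ 2) * (a * (m : ℝ) ^ 2 / (2 * M * r)) =
          2 * a ^ 2 * (m : ℝ) ^ 2 * (-3 * r ^ 2 + a ^ 2) / r := by
        field_simp
        ring
      have h3 : 2 * a ^ 2 * (m : ℝ) ^ 2 * (-3 * r ^ 2 + a ^ 2) / r + 4 * r * a ^ 2 * (m : ℝ) ^ 2 +
          2 * (r ^ 2 + a ^ 2) * (r - M) * Λ = 4 * (r - M) * (Λ * M * r - a ^ 2 * (m : ℝ) ^ 2) := by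
        field_simp
        linear_combination (2 * a ^ 2 * (m : ℝ) ^ 2 + 2 * r * (r - M) * Λ) * hA
      have h4 : 4 * m * a * M * ω * (-3 * r ^ 2 + a ^ 2) =
          4 * a * M * (-3 * r ^ 2 + a ^ 2) * ((m : ℝ) * ω) := by ring
      rw [h4]
      linarith [h1, h2, h3]
  exact hstep2.trans hstep1

/-- The constant `b = 4(r₊ − M)(Mr₊ − a²)/(r₊² + a²)³` of `le_deriv_sepPotential₀_rPlus` is
positive for `0 < M`, `|a| < M` (`r₊ > M > |a|`). DRSR arXiv:1402.7034, Lemma 6.4.1 ("`≥ bΛ`").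
[cite: DafermosRodnianskiShlapentokhrothman2014, Lemma 6.4.1] -/
theorem deriv_sepPotential₀_rPlus_const_pos {M a : ℝ} (hMa : IsSubextremal M a) :
    0 < 4 * (rPlus M a - M) * (M * rPlus M a - a ^ 2) / (rPlus M a ^ 2 + a ^ 2) ^ 3 := by
  have hM := hMa.pos
  have ha2 : a ^ 2 < M ^ 2 := sq_lt_sq' (abs_lt.1 hMa).1 (abs_lt.1 hMa).2
  have hrM : M < rPlus M a := by
    have : 0 < √(M ^ 2 - a ^ 2) := Real.sqrt_pos.2 (by nlinarith)
    unfold rPlus; linarith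
  have h1 : 0 < rPlus M a - M := sub_pos.2 hrM
  have h2 : 0 < M * rPlus M a - a ^ 2 := by nlinarith
  have hr : 0 < rPlus M a := hM.trans hrM
  exact div_pos (mul_pos (mul_pos (by norm_num) h1) h2) (by positivity)

/-- **The derivative of `V₁` at the horizon**: `dV₁/dr(r₊) = 2(r₊ − M)(3r₊² − 4Mr₊ + a²)/(r₊² + a²)³`
(product rule with `Δ(r₊) = 0`: only `Δ'(r₊) = 2(r₊ − M)` survives), for `|a| ≤ M`, `0 < M`; equal
to the printed `4Mr₊(r₊ − M)(r₊² − a²)/(r₊² + a²)⁴` (`deriv_sepPotential₁_rPlus_eq`). DRSR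
arXiv:1402.7034, proof of Lemma 6.4.1 (last identity). [cite: DafermosRodnianskiShlapentokhrothman2014, Lemma 6.4.1 (proof)] -/
theorem hasDerivAt_sepPotential₁_rPlus {M a : ℝ} (h : |a| ≤ M) (hM : 0 < M) :
    HasDerivAt (sepPotential₁ M a)
      (2 * (rPlus M a - M) * (3 * rPlus M a ^ 2 - 4 * M * rPlus M a + a ^ 2) /
        (rPlus M a ^ 2 + a ^ 2) ^ 3) (rPlus M a) := by
  have hr : 0 < rPlus M a := by
    unfold rPlus; linarith [Real.sqrt_nonneg (M ^ 2 - a ^ 2)]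
  -- `V₁ = Δ · G` with `G` differentiable at `r₊`; only `Δ'(r₊) G(r₊)` survives
  set G : ℝ → ℝ := fun s ↦ (3 * s ^ 2 - 4 * M * s + a ^ 2) / (s ^ 2 + a ^ 2) ^ 3 -
    3 * delta M a s * s ^ 2 / (s ^ 2 + a ^ 2) ^ 4 with hG_def
  have hGd : DifferentiableAt ℝ G (rPlus M a) := by
    have h1 : (rPlus M a ^ 2 + a ^ 2) ^ 3 ≠ 0 := by positivity
    have h2 : (rPlus M a ^ 2 + a ^ 2) ^ 4 ≠ 0 := by positivity
    simp only [hG_def, delta]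
    fun_prop (disch := assumption)
  have hprod := (hasDerivAt_delta M a (rPlus M a)).mul hGd.hasDerivAt
  rw [delta_rPlus h, zero_mul, add_zero] at hprod
  have hV : delta M a * G = sepPotential₁ M a := by
    funext s
    simp only [Pi.mul_apply, hG_def, sepPotential₁]
    ring
  rw [hV] at hprod
  refine hprod.congr_deriv ?_
  simp only [hG_def, delta_rPlus h]
  ring

/-- `dV₁/dr(r₊)` in the printed form `4Mr₊(r₊ − M)(r₊² − a²)/(r₊² + a²)⁴` (using
`r₊² + a² = 2Mr₊`). DRSR arXiv:1402.7034, proof of Lemma 6.4.1 (last identity). [cite: DafermosRodnianskiShlapentokhrothman2014, Lemma 6.4.1 (proof)] -/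
theorem deriv_sepPotential₁_rPlus_eq {M a : ℝ} (h : |a| ≤ M) (hM : 0 < M) :
    deriv (sepPotential₁ M a) (rPlus M a) =
      4 * M * rPlus M a * (rPlus M a - M) * (rPlus M a ^ 2 - a ^ 2) / (rPlus M a ^ 2 + a ^ 2) ^ 4 := by
  have hr : 0 < rPlus M a := by
    unfold rPlus; linarith [Real.sqrt_nonneg (M ^ 2 - a ^ 2)]
  rw [(hasDerivAt_sepPotential₁_rPlus h hM).deriv]
  have hA := rPlus_sq_add_sq h
  have hA0 : rPlus M a ^ 2 + a ^ 2 ≠ 0 := by positivity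
  field_simp
  linear_combination (2 * (rPlus M a - M) * (3 * rPlus M a ^ 2 + a ^ 2)) * hA

/-- `dV₁/dr(r₊) ≥ 0` for `|a| ≤ M`, `0 < M` (all factors of `4Mr₊(r₊ − M)(r₊² − a²)` are
nonnegative: `r₊ ≥ M ≥ |a|`). DRSR arXiv:1402.7034, proof of Lemma 6.4.1 ("`> 0`" there, for
`|a| < M`). [cite: DafermosRodnianskiShlapentokhrothman2014, Lemma 6.4.1 (proof)] -/
theorem deriv_sepPotential₁_rPlus_nonneg {M a : ℝ} (h : |a| ≤ M) (hM : 0 < M) :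
    0 ≤ deriv (sepPotential₁ M a) (rPlus M a) := by
  rw [deriv_sepPotential₁_rPlus_eq h hM]
  have hMr : M ≤ rPlus M a := by
    unfold rPlus; linarith [Real.sqrt_nonneg (M ^ 2 - a ^ 2)]
  have h1 : 0 ≤ rPlus M a - M := sub_nonneg.2 hMr
  have h2 : 0 ≤ rPlus M a ^ 2 - a ^ 2 := by
    have : |a| ≤ rPlus M a := h.trans hMr
    nlinarith [abs_nonneg a, sq_abs a]
  have hr : 0 ≤ rPlus M a := hM.le.trans hMr
  positivity

/-- **DRSR Lemma 6.4.1 (first assertion, for `V`)**: `dV/dr(r₊) ≥ dV₀/dr(r₊)` since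
`V = V₀ + V₁` and `dV₁/dr(r₊) ≥ 0` (`|a| ≤ M`, `0 < M`). [cite: DafermosRodnianskiShlapentokhrothman2014, Lemma 6.4.1] -/
theorem deriv_sepPotential₀_rPlus_le_deriv_sepPotential_rPlus {M a : ℝ} (h : |a| ≤ M) (hM : 0 < M)
    (ω : ℝ) (m : ℤ) (Λ : ℝ) :
    deriv (sepPotential₀ M a ω m Λ) (rPlus M a) ≤ deriv (sepPotential M a ω m Λ) (rPlus M a) := by
  have h0 := hasDerivAt_sepPotential₀_rPlus h hM ω m Λ
  have h1 := hasDerivAt_sepPotential₁_rPlus h hM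
  have hsum : HasDerivAt (sepPotential M a ω m Λ) _ (rPlus M a) := h0.add h1
  rw [hsum.deriv, h0.deriv, ← h1.deriv]
  linarith [deriv_sepPotential₁_rPlus_nonneg h hM]

end Kerr

end Literature.Geometry.Lorentzian

end
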